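import Summits.RiemannHypothesis.RiemannHypothesis.Theorems.WeilFormatCCinfMarginForm
import Literature.NumberTheory.LFunctions.PsdDyadicCertificate
import HarnessLib

/-!
# Format C, design C∞: the margin of the front door from ONE kernel PSD certificate (`PsdDyadic.checkPsdMid`)

Route context: Fourier–Galerkin / Schur-complement certificates of Weil positivity on a window ("format C", C∞ door;
cell memo `run/shared/lean/pub/rh-explicit/rh-explicit-weil-10/KERNEL-LEVER.md` §22; supporting stmt-RiemannHypothesis-0098;
seat rh-explicit-weil-10).  The last glue between the matrix-form margin of `weilPositivityOn_of_cinf_matrix`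
(`δ Σ_k z_k² ≤ Σ_k Σ_{k'} z_k z_{k'} S(k,k')` on `Fin (B+1) ⊕ Fin r`, `WeilFormatCCinfMarginForm`) and the kernel checker
`PsdDyadic.checkPsdMid` on `Fin (B+1+r)`: the entry boxes are stated BLOCKWISE on the `Sum` side with plain table indices
(`x`-block rows/columns `i`, profile rows/columns `B+1+j`), so a rung proves four families of entry enclosures (each by
its interval-arithmetic soundness lemma, `Sum.elim` reducing definitionally) and runs the checker once.

* `cinf_margin_of_checkPsdMid`.

Elementary; standard axioms; no definitions; no RH claim.
-/

set_option autoImplicit false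
-- `Summit.RiemannHypothesis.RiemannHypothesis.…` is the layout-mandated namespace (summit = problem name).
set_option linter.dupNamespace false

noncomputable section

open Finset

namespace Summit.RiemannHypothesis.RiemannHypothesis.Theorems.WeilFormatC

open Literature.NumberTheory.LFunctions

/-- **Margin from one `checkPsdMid`.**  For a matrix `S` on `Fin B ⊕ Fin r`, a margin `δr`, integer midpoints `mid`
(an `(B+r) × (B+r)` table, `x`-block first), radius `ρ`, unit `u > 0` and a factor `L` accepted by
`PsdDyadic.checkPsdMid (B + r) δ ρ mid L`: if blockwise
`|S(inl i, inl i') − δr[i=i'] − mid(i,i')·u| ≤ ρu`, `|S(inl i, inr j) − mid(i, B+j)·u| ≤ ρu`,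
`|S(inr j, inl i) − mid(B+j, i)·u| ≤ ρu`, `|S(inr j, inr j') − δr[j=j'] − mid(B+j, B+j')·u| ≤ ρu`,
then `δr Σ_k z_k² ≤ Σ_k Σ_{k'} z_k z_{k'} S(k,k')` for every `z`. -/
theorem cinf_margin_of_checkPsdMid {B r : ℕ} (S : Fin B ⊕ Fin r → Fin B ⊕ Fin r → ℝ) (δr : ℝ)
    {δ ρ : ℤ} {mid L : List (List ℤ)} (h : PsdDyadic.checkPsdMid (B + r) δ ρ mid L = true) {u : ℝ} (hu : 0 < u)
    (hxx : ∀ i i' : Fin B, |(S (Sum.inl i) (Sum.inl i') - if i = i' then δr else 0)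
        - (PsdDyadic.getMZ mid i i' : ℝ) * u| ≤ (ρ : ℝ) * u)
    (hxβ : ∀ (i : Fin B) (j : Fin r), |S (Sum.inl i) (Sum.inr j)
        - (PsdDyadic.getMZ mid i (B + j) : ℝ) * u| ≤ (ρ : ℝ) * u)
    (hβx : ∀ (j : Fin r) (i : Fin B), |S (Sum.inr j) (Sum.inl i)
        - (PsdDyadic.getMZ mid (B + j) i : ℝ) * u| ≤ (ρ : ℝ) * u)
    (hββ : ∀ j j' : Fin r, |(S (Sum.inr j) (Sum.inr j') - if j = j' then δr else 0)
        - (PsdDyadic.getMZ mid (B + j) (B + j') : ℝ) * u| ≤ (ρ : ℝ) * u)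
    (z : Fin B ⊕ Fin r → ℝ) :
    δr * ∑ k, z k ^ 2 ≤ ∑ k, ∑ k', z k * z k' * S k k' := by
  classical
  refine quadForm_margin_of_fin S δr (fun α ↦ ?_) z
  refine PsdDyadic.psd_of_checkPsdMid h hu
    (fun p p' ↦ S (finSumFinEquiv.symm p) (finSumFinEquiv.symm p') - if p = p' then δr else 0) (fun p p' ↦ ?_) α
  obtain ⟨k, rfl⟩ := finSumFinEquiv.surjective p
  obtain ⟨k', rfl⟩ := finSumFinEquiv.surjective p'
  simp only [Equiv.symm_apply_apply, EmbeddingLike.apply_eq_iff_eq]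
  rcases k with i | j <;> rcases k' with i' | j'
  · simpa only [finSumFinEquiv_apply_left, Fin.val_castAdd, Sum.inl.injEq] using hxx i i'
  · simpa only [finSumFinEquiv_apply_left, finSumFinEquiv_apply_right, Fin.val_castAdd, Fin.val_natAdd,
      reduceCtorEq, if_false, sub_zero] using hxβ i j'
  · simpa only [finSumFinEquiv_apply_left, finSumFinEquiv_apply_right, Fin.val_castAdd, Fin.val_natAdd,
      reduceCtorEq, if_false, sub_zero] using hβx j i'
  · simpa only [finSumFinEquiv_apply_right, Fin.val_natAdd, Sum.inr.injEq] using hββ j j'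

end Summit.RiemannHypothesis.RiemannHypothesis.Theorems.WeilFormatC

end
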